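import Mathlib.RepresentationTheory.Homological.GroupCohomology.Functoriality
import Mathlib.Algebra.Ring.ULift
import Mathlib.Algebra.Group.ULift
import Literature.Algebra.Homology.GroupCohomologyResolutionComparison
import HarnessLib

/-!
# Group cohomology classes with trivial coefficients descend along universe lifts

Topic `Algebra/Homology`; namespace `Literature.Algebra.Homology` (grouping sub-namespace
`GroupCohomologyULift`).  Definitions with bodies and theorems; Mathlib-only imports (plus the
tree's element-level lemmas of `GroupCohomologyResolutionComparison`); no named fact, no
instance, no `sorry`.

Mathlib's group cohomology `groupCohomology A n` and its functoriality `groupCohomology.map`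
require the ring `k`, the groups and the modules to live in ONE universe.  A statement that
quantifies over finite groups `Q : Type` (e.g. "some class on a finite quotient stays non-zero in
every larger finite quotient", the finite-level reading of the cohomology of a profinite
completion) but is proved from classes of `Hⁿ(G; -)` with `G : Type u` therefore needs a bridge
between `Hⁿ(Q; k)` (universe `0`) and `Hⁿ(ULift Q; ULift k)` (universe `u`).  This file provides
it for TRIVIAL coefficients, at the level of elements, through explicit inhomogeneous cocycles:

* `liftCochain` / `lowerCochain` — the bijection between inhomogeneous cochains
  `(Fin n → G) → k` and `(Fin n → ULift G) → ULift k`; `d_liftCochain` — it commutes with the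
  differentials (the formula for `d` is universe-free); hence cocycles and coboundaries correspond
  (`d_liftCochain_eq_zero_iff`, `exists_d_eq_liftCochain_iff`);
* `uliftHom φ : ULift G →* ULift H` and `upHom ψ : Γ →* ULift P` — lifted homomorphisms;
  `liftCochain_comp` — lifting is compatible with pull-backs;
* generic element-level lemmas in one universe: every class is the class of a cocycle
  (`exists_π_cocyclesMk_eq`), the class of a cocycle vanishes iff it is a coboundary
  (`π_cocyclesMk_eq_zero_iff`), and `φ^*` acts on classes of cocycles by composition
  (`map_π_cocyclesMk`, `d_comp`);
* **`exists_lower_class`** — for `X ∈ Hⁿ⁺¹(ULift G; ULift k)` there is `x ∈ Hⁿ⁺¹(G; k)` with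
  `φ^* x = 0 ↔ (ULift φ)^* X = 0` for every `φ : H →* G` (so `x = 0 ↔ X = 0`, and the vanishing
  of pull-backs is decided in either universe).

All of this is the standard independence of `H^*(G; k)` from set-theoretic bookkeeping
([Brown1982CohomologyGroups, III §1]: cohomology is computed from any projective resolution, here
the SAME normalised formula for the inhomogeneous differential in both universes; III §8 for the
functoriality `φ^*`).  Consumer: `Literature/Topology/FourManifolds/
AsphericalThreeManifoldProfiniteH3Proofs.lean` (the fact `profinite_H3_ne_zero_of_aspherical`
quantifies over finite quotients in `Type`, while goodness and `H³(π₁Z; 𝔽₂) ≠ 0` are proved in the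
universe of the manifold).

## References

* K. S. Brown, *Cohomology of Groups*, GTM 87, Springer (1982), III §1, III §8.
  [Brown1982CohomologyGroups]
-/

noncomputable section

open CategoryTheory groupCohomology

namespace Literature.Algebra.Homology

namespace GroupCohomologyULift

open ResolutionComparison

universe v u

/-! ### Element-level lemmas on classes of explicit cocycles (one universe) -/

section Generic

variable {k G H : Type u} [CommRing k] [Group G] [Group H]

/-- The differential of the complex of inhomogeneous cochains, on elements. [folklore] -/
theorem complex_d_apply (A : Rep.{u} k G) (n : ℕ) (w : (Fin n → G) → A) :
    (inhomogeneousCochains A).d n (n + 1) w = inhomogeneousCochains.d A n w := by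
  rw [inhomogeneousCochains.d_def]

/-- A cocycle (element of `cocycles A n`) has zero coboundary. [folklore] -/
theorem d_iCocycles (A : Rep.{u} k G) (n : ℕ) (z : cocycles A n) :
    inhomogeneousCochains.d A n (iCocycles A n z) = 0 := by
  have h := LinearMap.congr_fun
    (congrArg ModuleCat.Hom.hom ((inhomogeneousCochains A).iCycles_d n (n + 1))) z
  rw [ModuleCat.hom_comp, LinearMap.comp_apply, ModuleCat.hom_zero, LinearMap.zero_apply] at h
  rw [← complex_d_apply]
  exact h

/-- Every cocycle is `cocyclesMk` of its underlying cochain. [folklore] -/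
theorem cocyclesMk_iCocycles (A : Rep.{u} k G) (n : ℕ) (z : cocycles A n) :
    cocyclesMk (iCocycles A n z) (d_iCocycles A n z) = z := by
  apply iCycles_injective (inhomogeneousCochains A) n
  exact iCocycles_mk _ _

/-- Every class of `Hⁿ(G, A)` is the class of an inhomogeneous `n`-cocycle. [folklore] -/
theorem exists_π_cocyclesMk_eq (A : Rep.{u} k G) (n : ℕ) (x : groupCohomology A n) :
    ∃ (f : (Fin n → G) → A) (hf : inhomogeneousCochains.d A n f = 0),
      π A n (cocyclesMk f hf) = x := by
  obtain ⟨z, rfl⟩ := homologyπ_surjective (inhomogeneousCochains A) n x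
  refine ⟨iCocycles A n z, d_iCocycles A n z, ?_⟩
  rw [cocyclesMk_iCocycles]
  rfl

/-- The class of an `(n+1)`-cocycle vanishes iff the cocycle is a coboundary. [folklore] -/
theorem π_cocyclesMk_eq_zero_iff (A : Rep.{u} k G) (n : ℕ) (f : (Fin (n + 1) → G) → A)
    (hf : inhomogeneousCochains.d A (n + 1) f = 0) :
    π A (n + 1) (cocyclesMk f hf) = 0 ↔
      ∃ w : (Fin n → G) → A, inhomogeneousCochains.d A n w = f := by
  have h := homologyπ_apply_eq_zero_iff (inhomogeneousCochains A) (n + 1) (cocyclesMk f hf)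
  refine h.trans ?_
  change (∃ w : (Fin n → G) → A,
    (inhomogeneousCochains A).toCycles n (n + 1) w = cocyclesMk f hf) ↔ _
  refine exists_congr fun w => ?_
  constructor
  · intro hw
    have h := congrArg (iCocycles A (n + 1)) hw
    rw [iCycles_toCycles, iCocycles_mk, complex_d_apply] at h
    exact h
  · intro hw
    apply iCycles_injective (inhomogeneousCochains A) (n + 1)
    rw [iCycles_toCycles, iCocycles_mk, complex_d_apply]
    exact hw

/-- The cochain map induced by a group homomorphism (identity on coefficients), on elements:
`f ↦ f ∘ (φ ∘ ·)`. [folklore] -/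
theorem cochainsMap_id_f_apply (φ : G →* H) (A : Rep.{u} k H) (n : ℕ) (f : (Fin n → H) → A) :
    (cochainsMap φ (𝟙 (Rep.res φ A))).f n f = fun g => f (φ ∘ g) := by
  rfl

/-- Pulling back along a group homomorphism commutes with the differentials, on elements.
[folklore] -/
theorem d_comp (φ : G →* H) (A : Rep.{u} k H) (n : ℕ) (f : (Fin n → H) → A) :
    inhomogeneousCochains.d (Rep.res φ A) n (fun g => f (φ ∘ g)) =
      fun g => inhomogeneousCochains.d A n f (φ ∘ g) := by
  have hcomm := LinearMap.congr_fun (congrArg ModuleCat.Hom.hom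
    ((cochainsMap φ (𝟙 (Rep.res φ A))).comm n (n + 1))) f
  rw [ModuleCat.hom_comp, LinearMap.comp_apply, ModuleCat.hom_comp, LinearMap.comp_apply]
    at hcomm
  have h1 : (cochainsMap φ (𝟙 (Rep.res φ A))).f n f = fun g => f (φ ∘ g) := rfl
  have h2 : (cochainsMap φ (𝟙 (Rep.res φ A))).f (n + 1) (inhomogeneousCochains.d A n f) =
      fun g => inhomogeneousCochains.d A n f (φ ∘ g) := rfl
  rw [← h2, ← complex_d_apply, ← h1, ← complex_d_apply]
  exact hcomm

/-- Pulling back along a group homomorphism preserves cocycles. [folklore] -/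
theorem d_comp_eq_zero (φ : G →* H) (A : Rep.{u} k H) (n : ℕ) (f : (Fin n → H) → A)
    (hf : inhomogeneousCochains.d A n f = 0) :
    inhomogeneousCochains.d (Rep.res φ A) n (fun g => f (φ ∘ g)) = 0 := by
  rw [d_comp, hf]
  rfl

/-- `φ^*` on the class of a cocycle is the class of the pulled-back cocycle. [folklore] -/
theorem map_π_cocyclesMk (φ : G →* H) (A : Rep.{u} k H) (n : ℕ) (f : (Fin n → H) → A)
    (hf : inhomogeneousCochains.d A n f = 0) :
    map φ (𝟙 (Rep.res φ A)) n (π A n (cocyclesMk f hf)) =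
      π (Rep.res φ A) n (cocyclesMk (fun g => f (φ ∘ g)) (d_comp_eq_zero φ A n f hf)) := by
  rw [π_map_apply]
  congr 1
  apply iCycles_injective (inhomogeneousCochains (Rep.res φ A)) n
  rw [iCycles_cyclesMap, iCocycles_mk, iCocycles_mk]
  rfl

end Generic

/-! ### Lifting cochains of the trivial module along `ULift` -/

section LiftDefs

variable {k G : Type u}

/-- Lift an inhomogeneous cochain of the trivial module `k` of `G` to one of the trivial module
`ULift k` of `ULift G`. [folklore] -/
def liftCochain (n : ℕ) (f : (Fin n → G) → k) : (Fin n → ULift.{v} G) → ULift.{v} k :=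
  fun g => ULift.up (f fun i => (g i).down)

/-- Lower an inhomogeneous cochain of `ULift k` over `ULift G` to one of `k` over `G`.
[folklore] -/
def lowerCochain (n : ℕ) (F : (Fin n → ULift.{v} G) → ULift.{v} k) : (Fin n → G) → k :=
  fun g => (F fun i => ULift.up (g i)).down

/-- Unfolding `liftCochain`. [folklore] -/
@[simp]
theorem liftCochain_apply (n : ℕ) (f : (Fin n → G) → k) (g : Fin n → ULift.{v} G) :
    liftCochain n f g = ULift.up (f fun i => (g i).down) := rfl

/-- Unfolding `lowerCochain`. [folklore] -/
@[simp]
theorem lowerCochain_apply (n : ℕ) (F : (Fin n → ULift.{v} G) → ULift.{v} k) (g : Fin n → G) :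
    lowerCochain n F g = (F fun i => ULift.up (g i)).down := rfl

/-- `lowerCochain ∘ liftCochain = id`. [folklore] -/
@[simp]
theorem lowerCochain_liftCochain (n : ℕ) (f : (Fin n → G) → k) :
    lowerCochain n (liftCochain.{v} n f) = f := rfl

/-- `liftCochain ∘ lowerCochain = id`. [folklore] -/
@[simp]
theorem liftCochain_lowerCochain (n : ℕ) (F : (Fin n → ULift.{v} G) → ULift.{v} k) :
    liftCochain n (lowerCochain n F) = F := rfl

/-- `liftCochain` is injective. [folklore] -/
theorem liftCochain_injective (n : ℕ) :
    Function.Injective (liftCochain.{v} (k := k) (G := G) n) := fun f f' h => by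
  rw [← lowerCochain_liftCochain n f, h, lowerCochain_liftCochain]

end LiftDefs

section Lift

variable {k G H : Type u} [CommRing k] [Group G] [Group H]

omit [Group G] in
/-- `liftCochain 0 = 0`. [folklore] -/
@[simp]
theorem liftCochain_zero (n : ℕ) : liftCochain.{v} n (0 : (Fin n → G) → k) = 0 := rfl

/-- The trivial representation `k` of `G`, lifted to the universe `max u v`: the trivial
representation `ULift k` of `ULift G`. [folklore] -/
abbrev trivialULift (k G : Type u) [CommRing k] [Group G] : Rep (ULift.{v} k) (ULift.{v} G) :=
  Rep.trivial (ULift.{v} k) (ULift.{v} G) (ULift.{v} k)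

/-- **Lifting commutes with the differentials.** [folklore] -/
theorem d_liftCochain (n : ℕ) (f : (Fin n → G) → k) :
    inhomogeneousCochains.d (trivialULift.{v} k G) n (liftCochain n f) =
      liftCochain (n + 1) (inhomogeneousCochains.d (Rep.trivial k G k) n f) := by
  have hsum : ∀ h : Fin (n + 1) → ULift.{v} k,
      (∑ j, h j).down = ∑ j, (h j).down := fun h =>
    map_sum (AddEquiv.ulift : ULift.{v} k ≃+ k) h Finset.univ
  have hc : ∀ j : Fin (n + 1), ∀ g : Fin (n + 1) → ULift.{v} G,
      (fun i => (j.contractNth (· * ·) g i).down) = j.contractNth (· * ·) (fun i => (g i).down) :=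
    fun j g => Fin.comp_contractNth (f := ULift.down) _ _ (fun _ _ => rfl) j g
  funext g
  apply ULift.down_injective
  simp only [inhomogeneousCochains.d_hom_apply, liftCochain_apply, Representation.trivial_apply,
    ULift.add_down, hsum, smul_eq_mul, ULift.mul_down, ULift.pow_down, ULift.neg_down,
    ULift.one_down, hc]

/-- Lifting a cochain has zero coboundary iff the cochain has. [folklore] -/
theorem d_liftCochain_eq_zero_iff (n : ℕ) (f : (Fin n → G) → k) :
    inhomogeneousCochains.d (trivialULift.{v} k G) n (liftCochain n f) = 0 ↔
      inhomogeneousCochains.d (Rep.trivial k G k) n f = 0 := by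
  rw [d_liftCochain, ← liftCochain_zero, (liftCochain_injective (n + 1)).eq_iff]

/-- A lifted cochain is a coboundary iff the cochain is. [folklore] -/
theorem exists_d_eq_liftCochain_iff (n : ℕ) (f : (Fin (n + 1) → G) → k) :
    (∃ W : (Fin n → ULift.{v} G) → ULift.{v} k,
        inhomogeneousCochains.d (trivialULift.{v} k G) n W = liftCochain (n + 1) f) ↔
      ∃ w : (Fin n → G) → k, inhomogeneousCochains.d (Rep.trivial k G k) n w = f := by
  constructor
  · rintro ⟨W, hW⟩
    refine ⟨lowerCochain n W, liftCochain_injective (n + 1) ?_⟩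
    rw [← d_liftCochain, liftCochain_lowerCochain, hW]
  · rintro ⟨w, rfl⟩
    exact ⟨liftCochain n w, d_liftCochain n w⟩

/-- The homomorphism `ULift G →* ULift H` lifting `φ : G →* H`. [folklore] -/
def uliftHom (φ : G →* H) : ULift.{v} G →* ULift.{v} H :=
  MulEquiv.ulift.symm.toMonoidHom.comp (φ.comp MulEquiv.ulift.toMonoidHom)

/-- Unfolding `uliftHom`. [folklore] -/
@[simp]
theorem uliftHom_apply (φ : G →* H) (g : ULift.{v} G) : uliftHom φ g = ULift.up (φ g.down) :=
  rfl

/-- A homomorphism `ψ : Γ →* G` with values lifted to `ULift G` (typically `G` in a lower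
universe than `Γ`). [folklore] -/
def upHom {Γ : Type*} [Group Γ] (ψ : Γ →* G) : Γ →* ULift.{v} G :=
  MulEquiv.ulift.symm.toMonoidHom.comp ψ

/-- Unfolding `upHom`. [folklore] -/
@[simp]
theorem upHom_apply {Γ : Type*} [Group Γ] (ψ : Γ →* G) (γ : Γ) : upHom ψ γ = ULift.up (ψ γ) :=
  rfl

omit [CommRing k] in
/-- Lifting cochains is compatible with pulling back along group homomorphisms. [folklore] -/
theorem liftCochain_comp (φ : G →* H) (n : ℕ) (f : (Fin n → H) → k) :
    liftCochain.{v} n (fun g => f (φ ∘ g)) = fun g => liftCochain.{v} n f (uliftHom φ ∘ g) :=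
  rfl

/-- **Universe descent of group cohomology classes with trivial coefficients, compatibly with
pull-backs.**  Every class `X ∈ Hⁿ⁺¹(ULift G; ULift k)` (trivial coefficients, computed in the
universe `max u v`) has a companion class `x ∈ Hⁿ⁺¹(G; k)` (computed in the universe `u` of `G`
and `k`) such that, for every group homomorphism `φ : H → G`, `φ^* x = 0` iff `(ULift φ)^* X = 0`
(in particular, `φ = id`: `x = 0 ↔ X = 0`).  Mathlib's `groupCohomology.map` only relates groups
of one universe; this is the substitute across universes, through explicit inhomogeneous
cocycles (`x` is the class of the lowered cocycle of any cocycle representing `X`).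
[folklore] [cite: Brown1982CohomologyGroups, III §1 (independence of choices) and III §8 (functoriality)] -/
theorem exists_lower_class (n : ℕ) (X : groupCohomology (trivialULift.{v} k G) (n + 1)) :
    ∃ x : groupCohomology (Rep.trivial k G k) (n + 1),
      ∀ (H : Type u) [Group H] (φ : H →* G),
        map φ (𝟙 (Rep.res φ (Rep.trivial k G k))) (n + 1) x = 0 ↔
          map (uliftHom.{v} φ) (𝟙 (Rep.res (uliftHom.{v} φ) (trivialULift.{v} k G))) (n + 1)
            X = 0 := by
  obtain ⟨F, hF, rfl⟩ := exists_π_cocyclesMk_eq _ _ X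
  have hf : inhomogeneousCochains.d (Rep.trivial k G k) (n + 1) (lowerCochain (n + 1) F) = 0 := by
    rw [← d_liftCochain_eq_zero_iff, liftCochain_lowerCochain]
    exact hF
  refine ⟨π _ _ (cocyclesMk (lowerCochain (n + 1) F) hf), fun H _ φ => ?_⟩
  rw [map_π_cocyclesMk, map_π_cocyclesMk, π_cocyclesMk_eq_zero_iff, π_cocyclesMk_eq_zero_iff]
  have key := (exists_d_eq_liftCochain_iff.{v} (k := k) (G := H) n
    (fun g => lowerCochain (n + 1) F (φ ∘ g))).symm
  rw [liftCochain_comp, liftCochain_lowerCochain] at key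
  exact key

end Lift

end GroupCohomologyULift

end Literature.Algebra.Homology
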